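import Literature.Analysis.FluidPDE.LocalTypeIReverseTools
import Literature.Analysis.FluidPDE.SuitableWeakRescaling
import Literature.Analysis.FluidPDE.SuitableWeakPressure
import HarnessLib

/-!
# The blow-down sequence of Albritton–Barker's reverse direction (tools, II: the zoomed triple)

Trunk T-FLUID (`Literature/Analysis/FluidPDE`), family NS; proofs layer over
`Literature/Analysis/FluidPDE/LocalTypeI.lean` (Albritton–Barker 2019, Thm 1.1, corrected
rendering `Literature.Analysis.FluidPDE.AlbrittonBarkerTypeICharacterization`). No new
definitions.

Albritton–Barker 2019, §3, reverse direction: the blow-down sequence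
`v^{(k)}(x, t) = k v(k x, k² t)` "of suitable weak solutions" on `Q(2)` satisfies the uniform
estimate (3.3), `sup_k 𝐈(v^{(k)}, Q(2)) < ∞`, and hence the hypotheses of Lemma 2.2. For the
zoomed triple `(v_c, q_c, ∇v_c) = (c u₀ ∘ Φ, c² p₀ ∘ Φ, c² ∇u₀ ∘ Φ)`,
`Φ(s, y) = (t₁ + c² s, x₁ + c y)`, `t₁ < 0`, of a suitable weak solution `(u₀, p₀)` on
`ℝ³ × ℝ₋` with `𝐈 < ∞`, this file proves:

* `parabolicCylinderOpens_le_stPreimage_slab`, `compactCylinder_subset_stPreimage_slab`: the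
  balls `Q(0, R)` and the compact `[-1, 0] × B̄(0, 1)` lie in `Φ⁻¹(ℝ³ × ℝ₋)`;
* `zoom_isSuitableWeakSolutionOn`, `zoom_hasWeakSpatialGradientOn`: covariance
  (`IsSuitableWeakSolutionOn.stRescale` with `α = γ = c`, `β = c²`, unit viscosity, no force);
* `abScaledSum_zoom_le_typeIBound`: `(A + C + D + E)(Q(z, r); v_c, q_c, ∇v_c) ≤ 𝐈(u₀)` for
  balls with `t ≤ 0` (scale invariance, `LocalTypeIScaling`);
* `memLp_zoom_pressure`, `memLp_zoom_pressure_mean`: `q_c` and its `B(0, 1)`-means are in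
  `L^{3/2}(Q(0, 1))`;
* `isSuitableWeakSolutionInBall_zoom`: with the pressure normalised to mean zero on `B(0, 1)`
  (`IsSuitableWeakSolutionOn.sub_pressure`), the zoomed triple satisfies the hypotheses of A–B
  Lemma 2.2 in `Q(0, 1)`; `eLpNorm_zoom_velocity_le`, `eLpNorm_zoom_pressure_le`: the uniform
  bounds `‖v_c‖_{L³(Q(0,1))} ≤ 𝐈^{1/3}`, `‖q_c - [q_c]‖_{L^{3/2}(Q(0,1))} ≤ 𝐈^{2/3}`.

## References

* D. Albritton, T. Barker, *On local Type I singularities of the Navier–Stokes equations and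
  Liouville theorems*, J. Math. Fluid Mech. 21 (2019), arXiv:1811.00502, §3 (proof of Thm 1.1,
  reverse direction, the estimate (3.3)).
-/

noncomputable section

open MeasureTheory Set Function Filter Topology TopologicalSpace Metric
open scoped NNReal ENNReal InnerProductSpace RealInnerProductSpace

namespace Literature.Analysis.FluidPDE

/-! ### The zoomed triple -/

section Zoom

variable {u₀ : ℝ → EuclideanSpace ℝ (Fin 3) → EuclideanSpace ℝ (Fin 3)}
  {p₀ : ℝ → EuclideanSpace ℝ (Fin 3) → ℝ}
  {G₀ : ℝ → EuclideanSpace ℝ (Fin 3) → EuclideanSpace ℝ (Fin 3) →L[ℝ] EuclideanSpace ℝ (Fin 3)}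
  {c t₁ : ℝ} {x₁ : EuclideanSpace ℝ (Fin 3)}

/-- For `t₁ < 0` every ball `Q(0, R)` lies in the zoomed half space
`Φ⁻¹(ℝ³ × ℝ₋)`, `Φ(s, y) = (t₁ + c² s, x₁ + c y)`. [folklore] -/
theorem parabolicCylinderOpens_le_stPreimage_slab (c : ℝ) (ht₁ : t₁ < 0)
    (x₁ : EuclideanSpace ℝ (Fin 3)) (R : ℝ) :
    parabolicCylinderOpens R (0 : ℝ × EuclideanSpace ℝ (Fin 3)) ≤
      stPreimage (c ^ 2) c t₁ x₁ (slab (EuclideanSpace ℝ (Fin 3)) (Iio 0) isOpen_Iio) := by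
  intro w hw
  have hw' : w ∈ parabolicCylinder R (0 : ℝ × EuclideanSpace ℝ (Fin 3)) := hw
  rw [mem_parabolicCylinder] at hw'
  have h1 : w.1 < 0 := by simpa using hw'.1.2
  show stAffine (c ^ 2) c t₁ x₁ w ∈ (slab (EuclideanSpace ℝ (Fin 3)) (Iio 0) isOpen_Iio : Opens _)
  rw [mem_slab, stAffine_fst]
  show t₁ + c ^ 2 * w.1 < 0
  nlinarith [sq_nonneg c]

/-- The compact cylinder `[-1, 0] × B̄(0, 1) ⊇ Q(0, 1)` lies in the zoomed half space when
`t₁ < 0`. [folklore] -/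
theorem compactCylinder_subset_stPreimage_slab (c : ℝ) (ht₁ : t₁ < 0)
    (x₁ : EuclideanSpace ℝ (Fin 3)) :
    Icc (-1 : ℝ) 0 ×ˢ closedBall (0 : EuclideanSpace ℝ (Fin 3)) 1 ⊆
      (stPreimage (c ^ 2) c t₁ x₁ (slab (EuclideanSpace ℝ (Fin 3)) (Iio 0) isOpen_Iio) :
        Set (ℝ × EuclideanSpace ℝ (Fin 3))) := by
  rintro ⟨s, y⟩ ⟨⟨-, hs2⟩, -⟩
  show stAffine (c ^ 2) c t₁ x₁ (s, y) ∈
    (slab (EuclideanSpace ℝ (Fin 3)) (Iio 0) isOpen_Iio : Opens _)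
  rw [mem_slab, stAffine_fst]
  show t₁ + c ^ 2 * s < 0
  nlinarith [sq_nonneg c]

/-- `Q(0, 1) ⊆ [-1, 0] × B̄(0, 1)`. [folklore] -/
theorem parabolicCylinder_one_zero_subset :
    parabolicCylinder 1 (0 : ℝ × EuclideanSpace ℝ (Fin 3)) ⊆
      Icc (-1 : ℝ) 0 ×ˢ closedBall (0 : EuclideanSpace ℝ (Fin 3)) 1 := by
  rintro ⟨s, y⟩ hw
  rw [mem_parabolicCylinder] at hw
  obtain ⟨⟨h1, h2⟩, h3⟩ := hw
  simp only [Prod.fst_zero, Prod.snd_zero] at h1 h2 h3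
  exact ⟨⟨by linarith, h2.le⟩, mem_closedBall.2 h3.le⟩

/-- **The zoomed triple is a suitable weak solution on the zoomed half space** (covariance of
suitable weak solutions under the Navier–Stokes scaling, `IsSuitableWeakSolutionOn.stRescale`
with `α = γ = c`, `β = c²`: viscosity `c · 1 / c = 1`, zero force). [folklore] -/
theorem zoom_isSuitableWeakSolutionOn
    (hsw : IsSuitableWeakSolutionOn (slab (EuclideanSpace ℝ (Fin 3)) (Iio 0) isOpen_Iio) 1 0 u₀ p₀)
    (hc : 0 < c) (t₁ : ℝ) (x₁ : EuclideanSpace ℝ (Fin 3)) :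
    IsSuitableWeakSolutionOn
      (stPreimage (c ^ 2) c t₁ x₁ (slab (EuclideanSpace ℝ (Fin 3)) (Iio 0) isOpen_Iio))
      1 0 (c • stPull (c ^ 2) c t₁ x₁ u₀) (c ^ 2 • stPull (c ^ 2) c t₁ x₁ p₀) := by
  have h := hsw.stRescale hc hc (sq c) t₁ x₁
  have e1 : c * 1 / c = 1 := by field_simp
  have e2 : ((c ^ 2 * c) • stPull (c ^ 2) c t₁ x₁
      (0 : ℝ → EuclideanSpace ℝ (Fin 3) → EuclideanSpace ℝ (Fin 3))) = 0 := by
    funext t x; simp [stPull]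
  rwa [e1, e2] at h

/-- The zoomed weak spatial gradient: `∇v_c = c² (∇u₀) ∘ Φ` on the zoomed half space
(`HasWeakSpatialGradientOn.stRescale`). [folklore] -/
theorem zoom_hasWeakSpatialGradientOn
    (hwg : HasWeakSpatialGradientOn (slab (EuclideanSpace ℝ (Fin 3)) (Iio 0) isOpen_Iio) u₀ G₀)
    (hc : 0 < c) (t₁ : ℝ) (x₁ : EuclideanSpace ℝ (Fin 3)) :
    HasWeakSpatialGradientOn
      (stPreimage (c ^ 2) c t₁ x₁ (slab (EuclideanSpace ℝ (Fin 3)) (Iio 0) isOpen_Iio))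
      (c • stPull (c ^ 2) c t₁ x₁ u₀) (c ^ 2 • stPull (c ^ 2) c t₁ x₁ G₀) := by
  have h := hwg.stRescale c (by positivity : 0 < c ^ 2) hc t₁ x₁
  rwa [← sq] at h

/-- **The Type I bound is inherited by the zoomed triple**: for every ball `Q(z, r)` with
`t ≤ 0`, `(A + C + D + E)(Q(z, r); v_c, q_c, ∇v_c) ≤ 𝐈(u₀)` (scale invariance
`abScaledSum_nsZoom`, the image ball lying in `ℝ³ × ℝ₋` as `t₁ ≤ 0`; A–B §3, (3.3)).
[cite: AlbrittonBarker2019, §3] -/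
theorem abScaledSum_zoom_le_typeIBound (hc : 0 < c) (ht₁ : t₁ ≤ 0) (x₁ : EuclideanSpace ℝ (Fin 3))
    {r : ℝ} (hr : 0 < r) {z : ℝ × EuclideanSpace ℝ (Fin 3)} (hz : z.1 ≤ 0) :
    abScaledSum r z (c • stPull (c ^ 2) c t₁ x₁ u₀) (c ^ 2 • stPull (c ^ 2) c t₁ x₁ p₀)
        (c ^ 2 • stPull (c ^ 2) c t₁ x₁ G₀) ≤
      typeIBound (Iio (0 : ℝ) ×ˢ (univ : Set (EuclideanSpace ℝ (Fin 3)))) u₀ p₀ G₀ := by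
  rw [abScaledSum_nsZoom hc hr]
  refine abScaledSum_le_typeIBound (mul_pos hc hr) (parabolicCylinder_subset_lowerHalf ?_ _)
  rw [stAffine_fst]
  nlinarith [sq_nonneg c, mul_nonneg (sq_nonneg c) (neg_nonneg.2 hz)]

/-- The zoomed pressure lies in `L^{3/2}(Q(0, 1))` when `t₁ < 0` (the pressure class on the
compact `[-1, 0] × B̄(0, 1)` inside the zoomed half space). [folklore] -/
theorem memLp_zoom_pressure
    (hsw : IsSuitableWeakSolutionOn (slab (EuclideanSpace ℝ (Fin 3)) (Iio 0) isOpen_Iio) 1 0 u₀ p₀)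
    (hc : 0 < c) (ht₁ : t₁ < 0) (x₁ : EuclideanSpace ℝ (Fin 3)) :
    MemLp (uncurry (c ^ 2 • stPull (c ^ 2) c t₁ x₁ p₀)) (3 / 2)
      (volume.restrict (parabolicCylinder 1 (0 : ℝ × EuclideanSpace ℝ (Fin 3)))) := by
  obtain ⟨h32, h32', h32r⟩ := threeHalves_facts
  have h := zoom_isSuitableWeakSolutionOn hsw hc t₁ x₁
  have hKc : IsCompact (Icc (-1 : ℝ) 0 ×ˢ closedBall (0 : EuclideanSpace ℝ (Fin 3)) 1) :=
    isCompact_Icc.prod (isCompact_closedBall _ _)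
  have hKsub := compactCylinder_subset_stPreimage_slab c ht₁ x₁
  have hQK := parabolicCylinder_one_zero_subset
  have hfin := h.pressure _ hKsub hKc
  have hli : LocallyIntegrableOn (uncurry (c ^ 2 • stPull (c ^ 2) c t₁ x₁ p₀)) _ volume :=
    h.distributional.2.2.1
  refine ⟨hli.aestronglyMeasurable.mono_measure
    (Measure.restrict_mono (hQK.trans hKsub) le_rfl), ?_⟩
  rw [eLpNorm_eq_lintegral_rpow_enorm_toReal (zero_lt_one.trans_le h32).ne' h32', h32r]
  refine ENNReal.rpow_lt_top_of_nonneg (by positivity) ?_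
  exact (lt_of_le_of_lt (lintegral_mono_set hQK) hfin).ne

/-- The time-dependent mean over `B(0, 1)` of the zoomed pressure is in `L^{3/2}(Q(0, 1))`.
[folklore] -/
theorem memLp_zoom_pressure_mean
    (hsw : IsSuitableWeakSolutionOn (slab (EuclideanSpace ℝ (Fin 3)) (Iio 0) isOpen_Iio) 1 0 u₀ p₀)
    (hc : 0 < c) (ht₁ : t₁ < 0) (x₁ : EuclideanSpace ℝ (Fin 3)) :
    MemLp (fun w : ℝ × EuclideanSpace ℝ (Fin 3) =>
        ⨍ y in ball (0 : EuclideanSpace ℝ (Fin 3)) 1, (c ^ 2 • stPull (c ^ 2) c t₁ x₁ p₀) w.1 y)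
      (3 / 2) (volume.restrict (parabolicCylinder 1 (0 : ℝ × EuclideanSpace ℝ (Fin 3)))) := by
  obtain ⟨h32, h32', -⟩ := threeHalves_facts
  have hpm := memLp_zoom_pressure hsw hc ht₁ x₁
  have hQ1 : parabolicCylinder 1 (0 : ℝ × EuclideanSpace ℝ (Fin 3)) =
      Ioo (-1 : ℝ) 0 ×ˢ ball (0 : EuclideanSpace ℝ (Fin 3)) 1 := by
    simp [parabolicCylinder]
  rw [hQ1] at hpm ⊢
  exact memLp_setAverage_slice (measure_ball_pos volume _ one_pos).ne' measure_ball_lt_top.ne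
    h32 h32' hpm

/-- **The zoomed triple satisfies the hypotheses of A–B Lemma 2.2 on `Q(0, 1)`**, with the
pressure normalised to mean zero on `B(0, 1)` at each time (`sub_pressure`): a suitable weak
solution in the ball with `esssup_t ∫_{B(0,1)} |v_c|² ≤ 𝐈`, `∫_{Q(0,1)} |∇v_c|² ≤ 𝐈`, and
pressure in `L^{3/2}(Q(0, 1))` (A–B §3: "the sequence `(v^{(k)})` of suitable weak solutions"
with the uniform estimate (3.3)). [cite: AlbrittonBarker2019, §3] -/
theorem isSuitableWeakSolutionInBall_zoom
    (hsw : IsSuitableWeakSolutionOn (slab (EuclideanSpace ℝ (Fin 3)) (Iio 0) isOpen_Iio) 1 0 u₀ p₀)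
    (hwg : HasWeakSpatialGradientOn (slab (EuclideanSpace ℝ (Fin 3)) (Iio 0) isOpen_Iio) u₀ G₀)
    (hI : typeIBound (Iio (0 : ℝ) ×ˢ (univ : Set (EuclideanSpace ℝ (Fin 3)))) u₀ p₀ G₀ ≠ ∞)
    (hc : 0 < c) (ht₁ : t₁ < 0) (x₁ : EuclideanSpace ℝ (Fin 3)) :
    IsSuitableWeakSolutionInBall 1 0 (c • stPull (c ^ 2) c t₁ x₁ u₀)
      (fun t x => (c ^ 2 • stPull (c ^ 2) c t₁ x₁ p₀) t x -
        ⨍ y in ball (0 : EuclideanSpace ℝ (Fin 3)) 1, (c ^ 2 • stPull (c ^ 2) c t₁ x₁ p₀) t y) := by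
  obtain ⟨h32, h32', h32r⟩ := threeHalves_facts
  set I := typeIBound (Iio (0 : ℝ) ×ˢ (univ : Set (EuclideanSpace ℝ (Fin 3)))) u₀ p₀ G₀ with hIdef
  have hle1 := parabolicCylinderOpens_le_stPreimage_slab c ht₁ x₁ 1
  have hsuit1 := (zoom_isSuitableWeakSolutionOn hsw hc t₁ x₁).of_le hle1
  have hwg1 := (zoom_hasWeakSpatialGradientOn hwg hc t₁ x₁).mono hle1
  have hbound : abScaledSum 1 0 (c • stPull (c ^ 2) c t₁ x₁ u₀) (c ^ 2 • stPull (c ^ 2) c t₁ x₁ p₀)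
      (c ^ 2 • stPull (c ^ 2) c t₁ x₁ G₀) ≤ I :=
    abScaledSum_zoom_le_typeIBound hc ht₁.le x₁ one_pos le_rfl
  have hpm := memLp_zoom_pressure hsw hc ht₁ x₁
  have hmean := memLp_zoom_pressure_mean hsw hc ht₁ x₁
  haveI : IsFiniteMeasure
      (volume.restrict (parabolicCylinder 1 (0 : ℝ × EuclideanSpace ℝ (Fin 3)))) :=
    ⟨by rw [Measure.restrict_apply_univ]; exact (volume_parabolicCylinder_ne_top 1 0).lt_top⟩
  refine ⟨?_, ?_, ⟨_, hwg1, ?_⟩, hpm.sub hmean⟩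
  · refine hsuit1.sub_pressure (IntegrableOn.locallyIntegrableOn (hmean.integrable h32))
      fun K hK _ => ?_
    have hfin := hmean.eLpNorm_lt_top
    rw [eLpNorm_eq_lintegral_rpow_enorm_toReal (zero_lt_one.trans_le h32).ne' h32', h32r] at hfin
    exact lt_of_le_of_lt (lintegral_mono_set hK)
      ((ENNReal.rpow_lt_top_iff_of_pos (by norm_num)).1 hfin)
  · refine ⟨I.toNNReal, ?_⟩
    have hA := cknAEss_le_abScaledSum.trans hbound
    unfold cknAEss at hA
    simp only [ENNReal.ofReal_one, inv_one, one_mul] at hA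
    filter_upwards [ENNReal.ae_le_essSup fun t : ℝ =>
      ∫⁻ x in ball (0 : ℝ × EuclideanSpace ℝ (Fin 3)).2 1,
        ‖(c • stPull (c ^ 2) c t₁ x₁ u₀) t x‖ₑ ^ 2]
      with t ht
    rw [ENNReal.coe_toNNReal hI]
    exact ht.trans hA
  · have hE := cknE_le_abScaledSum.trans hbound
    unfold cknE at hE
    rw [ENNReal.ofReal_one, inv_one, one_mul] at hE
    exact lt_of_le_of_lt hE hI.lt_top

/-- **Uniform `L³` bound of the zoomed velocities on `Q(0, 1)`**: `‖v_c‖_{L³(Q(0,1))} ≤ 𝐈^{1/3}`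
(`‖v_c‖³_{L³} = C(Q(0,1); v_c) ≤ 𝐈`; A–B (3.3)). [cite: AlbrittonBarker2019, §3] -/
theorem eLpNorm_zoom_velocity_le (hc : 0 < c) (ht₁ : t₁ ≤ 0) (x₁ : EuclideanSpace ℝ (Fin 3))
    (p₀ : ℝ → EuclideanSpace ℝ (Fin 3) → ℝ)
    (G₀ : ℝ → EuclideanSpace ℝ (Fin 3) → EuclideanSpace ℝ (Fin 3) →L[ℝ] EuclideanSpace ℝ (Fin 3)) :
    eLpNorm (uncurry (c • stPull (c ^ 2) c t₁ x₁ u₀)) 3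
        (volume.restrict (parabolicCylinder 1 (0 : ℝ × EuclideanSpace ℝ (Fin 3)))) ≤
      typeIBound (Iio (0 : ℝ) ×ˢ (univ : Set (EuclideanSpace ℝ (Fin 3)))) u₀ p₀ G₀ ^
        (1 / 3 : ℝ) := by
  have hC : cknC 1 0 (c • stPull (c ^ 2) c t₁ x₁ u₀) ≤
      typeIBound (Iio (0 : ℝ) ×ˢ (univ : Set (EuclideanSpace ℝ (Fin 3)))) u₀ p₀ G₀ :=
    (cknC_le_abScaledSum (p := c ^ 2 • stPull (c ^ 2) c t₁ x₁ p₀)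
      (G := c ^ 2 • stPull (c ^ 2) c t₁ x₁ G₀)).trans
      (abScaledSum_zoom_le_typeIBound (u₀ := u₀) hc ht₁ x₁ one_pos
        (show (0 : ℝ × EuclideanSpace ℝ (Fin 3)).1 ≤ 0 from le_rfl))
  unfold cknC at hC
  rw [ENNReal.ofReal_one, one_pow, inv_one, one_mul] at hC
  rw [eLpNorm_eq_lintegral_rpow_enorm_toReal (by norm_num) (by norm_num), ENNReal.toReal_ofNat]
  refine ENNReal.rpow_le_rpow ?_ (by norm_num)
  refine le_of_eq_of_le (lintegral_congr fun w => ?_) hC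
  show ‖(c • stPull (c ^ 2) c t₁ x₁ u₀) w.1 w.2‖ₑ ^ (3 : ℝ) =
    ‖(c • stPull (c ^ 2) c t₁ x₁ u₀) w.1 w.2‖ₑ ^ (3 : ℕ)
  rw [← ENNReal.rpow_natCast]
  norm_num

/-- **Uniform `L^{3/2}` bound of the normalised zoomed pressures on `Q(0, 1)`**:
`‖q_c - [q_c]_{B(0,1)}‖_{L^{3/2}(Q(0,1))} ≤ 𝐈^{2/3}` (`= D(Q(0,1); q_c)^{2/3}`; A–B (3.3)).
[cite: AlbrittonBarker2019, §3] -/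
theorem eLpNorm_zoom_pressure_le (hc : 0 < c) (ht₁ : t₁ ≤ 0) (x₁ : EuclideanSpace ℝ (Fin 3))
    (u₀ : ℝ → EuclideanSpace ℝ (Fin 3) → EuclideanSpace ℝ (Fin 3))
    (G₀ : ℝ → EuclideanSpace ℝ (Fin 3) → EuclideanSpace ℝ (Fin 3) →L[ℝ] EuclideanSpace ℝ (Fin 3)) :
    eLpNorm (uncurry fun t x => (c ^ 2 • stPull (c ^ 2) c t₁ x₁ p₀) t x -
        ⨍ y in ball (0 : EuclideanSpace ℝ (Fin 3)) 1, (c ^ 2 • stPull (c ^ 2) c t₁ x₁ p₀) t y)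
        (3 / 2)
        (volume.restrict (parabolicCylinder 1 (0 : ℝ × EuclideanSpace ℝ (Fin 3)))) ≤
      typeIBound (Iio (0 : ℝ) ×ˢ (univ : Set (EuclideanSpace ℝ (Fin 3)))) u₀ p₀ G₀ ^
        (2 / 3 : ℝ) := by
  obtain ⟨h32, h32', h32r⟩ := threeHalves_facts
  have hD : cknDOsc 1 0 (c ^ 2 • stPull (c ^ 2) c t₁ x₁ p₀) ≤
      typeIBound (Iio (0 : ℝ) ×ˢ (univ : Set (EuclideanSpace ℝ (Fin 3)))) u₀ p₀ G₀ :=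
    (cknDOsc_le_abScaledSum (u := c • stPull (c ^ 2) c t₁ x₁ u₀)
      (G := c ^ 2 • stPull (c ^ 2) c t₁ x₁ G₀)).trans
      (abScaledSum_zoom_le_typeIBound (p₀ := p₀) hc ht₁ x₁ one_pos
        (show (0 : ℝ × EuclideanSpace ℝ (Fin 3)).1 ≤ 0 from le_rfl))
  unfold cknDOsc at hD
  rw [ENNReal.ofReal_one, one_pow, inv_one, one_mul] at hD
  rw [eLpNorm_eq_lintegral_rpow_enorm_toReal (zero_lt_one.trans_le h32).ne' h32', h32r,
    show (1 / (3 / 2 : ℝ)) = 2 / 3 by norm_num]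
  refine ENNReal.rpow_le_rpow ?_ (by norm_num)
  refine le_of_eq_of_le (lintegral_congr fun w => ?_) hD
  simp only [uncurry, Prod.snd_zero]

end Zoom

end Literature.Analysis.FluidPDE
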